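import Summits.AnomalousDissipation.AnomalousDissipation.Theorems.SawtoothPulseCascadeK1LocalisedCascadeChirpCutoffOsc

/-!
# K1loc, line `Spectral` / thin start — helper: TOOLS FOR THE CORNER-TRACE BOUND (S-D constants, «CT» 1/2)

Helper file of the prover lane on the crux `K1LocalisedCascade` (stmt-AnomalousDissipation-19491), route
`SawtoothPulseCascade` (S-D fibre ledger; arbiter A23-7 (3): corner-trace track).  The corner-trace bound controls the window
energy of `(g₀·T)^` for the exact `N`-tooth chirp `g₀` and a trigonometric polynomial `T` of degree `< L` DIRECTLY in coefficient
space, `(g₀T)^(k) = Σ_l T̂(l) ĝ₀(k−l)`, through the values of `T` at the `2N` corners.  This file holds the three finite-sum tools: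
* §1 `sum_exp_two_pi_mul_div_eq` (orthogonality of the `N`-th roots of unity) and **`dft_parseval_range`**:
  `Σ_{r<N} ‖Σ_{ρ<N} e^{2πiρr/N} a_ρ‖² = N·Σ_{ρ<N} ‖a_ρ‖²`;
* §2 **`sum_inv_sq_le_of_modEq`**: for a finite set of integers `u ≥ D > 0` pairwise congruent mod `N ≥ 1`,
  `Σ_u 1/u² ≤ 1/D² + 1/(N·D)` (the elements are `≥ N` apart; `Finset.induction_on_min`);
* §3 **`chirpCoeff_eq_sin_mul`**: for INTEGER `q` the closed form of `…ChirpCoeff.fourierCoeff_exactChirp_eq` collapses to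
  `C_μ(q) = sin(π(μ+q)/2)·(1/(π(μ+q)) + 1/(π(μ−q)))` (`e^{−iπq}·sin(π(μ−q)/2) = sin(π(μ+q)/2)`).
No definitions; nothing about the crux. [cite: Grafakos2014, Prop. 3.1.2 (5), §3.1.3] [problem: turb]
-/

-- `Summit.<Summit>.<Problem>`: single-conjunct summit, the duplicate namespace segment is deliberate.
set_option linter.dupNamespace false

noncomputable section

namespace Summit.AnomalousDissipation.AnomalousDissipation.Theorems.SawtoothPulseCascade.K1Window

open MeasureTheory Set Filter Topology Function Complex
open scoped Real ComplexConjugate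

/-! ## §1 Orthogonality of roots of unity and the finite Parseval identity -/

/-- **Orthogonality of the `N`-th roots of unity**: for `0 ≤ ρ, ρ′ < N`,
`Σ_{r<N} exp(2πi(ρ−ρ′)r/N) = N` if `ρ = ρ′` and `0` otherwise. [folklore] -/
theorem sum_exp_two_pi_mul_div_eq {N : ℕ} (hN : 0 < N) {ρ ρ' : ℕ} (hρ : ρ < N) (hρ' : ρ' < N) :
    ∑ r ∈ Finset.range N, Complex.exp (2 * π * I * (((ρ : ℤ) - ρ' : ℤ) : ℂ) * r / N) =
      if ρ = ρ' then (N : ℂ) else 0 := by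
  have hNc : (N : ℂ) ≠ 0 := Nat.cast_ne_zero.mpr hN.ne'
  set z : ℂ := Complex.exp (2 * π * I * (((ρ : ℤ) - ρ' : ℤ) : ℂ) / N) with hz
  have hterm : ∀ r : ℕ, Complex.exp (2 * π * I * (((ρ : ℤ) - ρ' : ℤ) : ℂ) * r / N) = z ^ r := by
    intro r
    rw [hz, ← Complex.exp_nat_mul]; congr 1; field_simp
  simp_rw [hterm]
  split_ifs with h
  · subst h
    have hz1 : z = 1 := by rw [hz]; simp
    simp [hz1]
  · have hzN : z ^ N = 1 := by
      rw [hz, ← Complex.exp_nat_mul, show (N : ℂ) * (2 * π * I * (((ρ : ℤ) - ρ' : ℤ) : ℂ) / N) =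
        (((ρ : ℤ) - ρ' : ℤ) : ℂ) * (2 * π * I) by field_simp, Complex.exp_int_mul_two_pi_mul_I]
    have hz1 : z ≠ 1 := by
      intro h1
      rw [hz, Complex.exp_eq_one_iff] at h1
      obtain ⟨n, hn⟩ := h1
      field_simp at hn
      have hq' : ((ρ : ℤ) - ρ' : ℤ) = N * n := by exact_mod_cast hn
      have h3 : |((ρ : ℤ) - ρ' : ℤ)| < N := by rw [abs_lt]; constructor <;> omega
      rw [hq', abs_mul, Nat.abs_cast] at h3
      have hn0 : n = 0 := by
        by_contra hn0
        have : (1 : ℤ) ≤ |n| := Int.one_le_abs hn0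
        nlinarith [show (0 : ℤ) < N from by exact_mod_cast hN]
      rw [hn0, mul_zero] at hq'
      omega
    rw [geom_sum_eq hz1, hzN, sub_self, zero_div]

/-- **Finite Parseval identity** (DFT of length `N`): `Σ_{r<N} ‖Σ_{ρ<N} exp(2πiρr/N)·a_ρ‖² = N·Σ_{ρ<N} ‖a_ρ‖²`. [folklore] -/
theorem dft_parseval_range {N : ℕ} (hN : 0 < N) (a : ℕ → ℂ) :
    ∑ r ∈ Finset.range N, ‖∑ ρ ∈ Finset.range N, Complex.exp (2 * π * I * ρ * r / N) * a ρ‖ ^ 2 =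
      N * ∑ ρ ∈ Finset.range N, ‖a ρ‖ ^ 2 := by
  -- work in `ℂ`: `‖z‖² = z * conj z`
  have key : ∀ r : ℕ, ((‖∑ ρ ∈ Finset.range N, Complex.exp (2 * π * I * ρ * r / N) * a ρ‖ ^ 2 : ℝ) : ℂ) =
      ∑ ρ ∈ Finset.range N, ∑ ρ' ∈ Finset.range N,
        a ρ * conj (a ρ') * Complex.exp (2 * π * I * (((ρ : ℤ) - ρ' : ℤ) : ℂ) * r / N) := by
    intro r
    rw [← Complex.normSq_eq_norm_sq, ← Complex.mul_conj, Finset.sum_mul]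
    refine Finset.sum_congr rfl fun ρ _ => ?_
    rw [map_sum, Finset.mul_sum]
    refine Finset.sum_congr rfl fun ρ' _ => ?_
    rw [map_mul, ← Complex.exp_conj]
    have e : conj (2 * π * I * (ρ' : ℂ) * r / N) = -(2 * π * I * (ρ' : ℂ) * r / N) := by
      simp only [map_div₀, map_mul, map_ofNat, Complex.conj_ofReal, map_natCast, Complex.conj_I]; ring
    rw [e]
    have e2 : Complex.exp (2 * π * I * ρ * r / N) * a ρ * (Complex.exp (-(2 * π * I * (ρ' : ℂ) * r / N)) * conj (a ρ')) =
        a ρ * conj (a ρ') * (Complex.exp (2 * π * I * ρ * r / N) * Complex.exp (-(2 * π * I * (ρ' : ℂ) * r / N))) := by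
      ring
    rw [e2, ← Complex.exp_add]
    congr 2; push_cast; ring
  have h : ∑ r ∈ Finset.range N, ((‖∑ ρ ∈ Finset.range N, Complex.exp (2 * π * I * ρ * r / N) * a ρ‖ ^ 2 : ℝ) : ℂ) =
      (N : ℂ) * ∑ ρ ∈ Finset.range N, ((‖a ρ‖ ^ 2 : ℝ) : ℂ) := by
    simp_rw [key]
    rw [Finset.sum_comm]
    -- now `Σ_ρ Σ_r Σ_ρ' …` : bring the `r`-sum inside
    have inner : ∀ ρ ∈ Finset.range N, ∑ r ∈ Finset.range N, ∑ ρ' ∈ Finset.range N,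
        a ρ * conj (a ρ') * Complex.exp (2 * π * I * (((ρ : ℤ) - ρ' : ℤ) : ℂ) * r / N) = N * (a ρ * conj (a ρ)) := by
      intro ρ hρ
      rw [Finset.sum_comm]
      have h2 : ∀ ρ' ∈ Finset.range N, ∑ r ∈ Finset.range N,
          a ρ * conj (a ρ') * Complex.exp (2 * π * I * (((ρ : ℤ) - ρ' : ℤ) : ℂ) * r / N) =
          a ρ * conj (a ρ') * (if ρ = ρ' then (N : ℂ) else 0) := by
        intro ρ' hρ'
        rw [← Finset.mul_sum, sum_exp_two_pi_mul_div_eq hN (Finset.mem_range.mp hρ) (Finset.mem_range.mp hρ')]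
      rw [Finset.sum_congr rfl h2]
      simp_rw [mul_ite, mul_zero]
      rw [Finset.sum_ite_eq, if_pos hρ]
      ring
    rw [Finset.sum_congr rfl inner, Finset.mul_sum]
    refine Finset.sum_congr rfl fun ρ _ => ?_
    rw [Complex.mul_conj, Complex.normSq_eq_norm_sq]
  exact_mod_cast h

/-! ## §2 Sums of `1/u²` over integers in one residue class -/

/-- **`Σ 1/u²` over a residue class beyond `D`**: if every element of the finite set `U ⊆ ℤ` is `≥ D > 0` and any two are congruent
mod `N ≥ 1`, then `Σ_{u∈U} 1/u² ≤ 1/D² + 1/(N·D)` (distinct elements differ by at least `N`; induction on the minimum). [folklore] -/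
theorem sum_inv_sq_le_of_modEq {N : ℕ} (hN : 0 < N) (U : Finset ℤ) :
    ∀ D : ℤ, 0 < D → (∀ u ∈ U, D ≤ u) → (∀ u ∈ U, ∀ v ∈ U, u ≡ v [ZMOD N]) →
      ∑ u ∈ U, 1 / ((u : ℝ)) ^ 2 ≤ 1 / (D : ℝ) ^ 2 + 1 / ((N : ℝ) * D) := by
  induction U using Finset.induction_on_min with
  | empty =>
    intro D hD _ _
    simp only [Finset.sum_empty]
    positivity
  | insert a s has ih =>
    intro D hD hge hmod
    have haD : D ≤ a := hge a (Finset.mem_insert_self a s)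
    have hna : a ∉ s := fun h => lt_irrefl a (has a h)
    rw [Finset.sum_insert hna]
    -- the other elements are `≥ a + N`
    have hs : ∀ u ∈ s, a + N ≤ u := by
      intro u hu
      have hlt := has u hu
      have hm := hmod u (Finset.mem_insert_of_mem hu) a (Finset.mem_insert_self a s)
      have hdvd : (N : ℤ) ∣ u - a := (Int.ModEq.dvd hm.symm)
      obtain ⟨c, hc⟩ := hdvd
      have hc1 : 1 ≤ c := by
        by_contra h
        push Not at h
        have : u - a ≤ 0 := by rw [hc]; nlinarith [show (0 : ℤ) < N from by exact_mod_cast hN]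
        omega
      nlinarith [show (0 : ℤ) < N from by exact_mod_cast hN]
    have hmods : ∀ u ∈ s, ∀ v ∈ s, u ≡ v [ZMOD N] := fun u hu v hv =>
      hmod u (Finset.mem_insert_of_mem hu) v (Finset.mem_insert_of_mem hv)
    have h1 := ih (a + N) (by omega) hs hmods
    have haR : (0 : ℝ) < a := by exact_mod_cast hD.trans_le haD
    have hDR : (0 : ℝ) < D := by exact_mod_cast hD
    have hNR : (0 : ℝ) < N := by exact_mod_cast hN
    have haDR : (D : ℝ) ≤ a := by exact_mod_cast haD
    -- `1/a² + 1/(a+N)² + 1/(N(a+N)) ≤ 1/a² + 1/(N a) ≤ 1/D² + 1/(N D)`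
    have e1 : (((a + N : ℤ)) : ℝ) = (a : ℝ) + N := by push_cast; ring
    rw [e1] at h1
    have h2 : 1 / ((a : ℝ) + N) ^ 2 + 1 / ((N : ℝ) * ((a : ℝ) + N)) ≤ 1 / ((N : ℝ) * a) := by
      have h2a : 1 / ((N : ℝ) * a) - 1 / ((N : ℝ) * ((a : ℝ) + N)) = 1 / ((a : ℝ) * ((a : ℝ) + N)) := by
        field_simp; ring
      have h2b : 1 / ((a : ℝ) + N) ^ 2 ≤ 1 / ((a : ℝ) * ((a : ℝ) + N)) :=
        one_div_le_one_div_of_le (by positivity) (by nlinarith)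
      linarith
    have h3 : 1 / (a : ℝ) ^ 2 ≤ 1 / (D : ℝ) ^ 2 := one_div_le_one_div_of_le (by positivity) (by nlinarith)
    have h4 : 1 / ((N : ℝ) * a) ≤ 1 / ((N : ℝ) * D) :=
      one_div_le_one_div_of_le (by positivity) (mul_le_mul_of_nonneg_left haDR hNR.le)
    linarith

/-! ## §3 The closed form of the chirp coefficients at integer arguments -/

/-- **The closed form collapses at integers**: for `q ∈ ℤ`, `e^{−iπq}·sin(π(μ−q)/2) = sin(π(μ+q)/2)`, hence
`C_μ(q) = sin(π(μ+q)/2)·(1/(π(μ+q)) + 1/(π(μ−q)))`. [folklore] -/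
theorem chirpCoeff_eq_sin_mul (μ : ℝ) (q : ℤ) :
    ((Real.sin (π * (μ + q) / 2) / (π * (μ + q)) : ℝ) : ℂ) +
        Complex.exp (-(π * I * q)) * ((Real.sin (π * (μ - q) / 2) / (π * (μ - q)) : ℝ) : ℂ) =
      ((Real.sin (π * (μ + q) / 2) * (1 / (π * (μ + q)) + 1 / (π * (μ - q))) : ℝ) : ℂ) := by
  -- `e^{−iπq} = (−1)^q = cos(πq)` and `sin(π(μ−q)/2) = sin(π(μ+q)/2 − πq) = cos(πq)·sin(π(μ+q)/2)`
  have hcos : Complex.exp (-(π * I * q)) = ((Real.cos (π * q) : ℝ) : ℂ) := by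
    have h1 : Complex.exp (-(π * I * q)) = Complex.exp (((-(π * q) : ℝ) : ℂ) * I) := by
      congr 1; push_cast; ring
    rw [h1, Complex.exp_mul_I, ← Complex.ofReal_cos, ← Complex.ofReal_sin, Real.cos_neg, Real.sin_neg]
    have hs : Real.sin (π * q) = 0 := by
      rw [mul_comm]; exact_mod_cast Real.sin_int_mul_pi q
    rw [hs]; push_cast; ring
  have hsin : Real.sin (π * (μ - q) / 2) = Real.cos (π * q) * Real.sin (π * (μ + q) / 2) := by
    have e : π * (μ - q) / 2 = π * (μ + q) / 2 - π * q := by ring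
    rw [e, Real.sin_sub]
    have hs : Real.sin (π * q) = 0 := by
      rw [mul_comm]; exact_mod_cast Real.sin_int_mul_pi q
    rw [hs]; ring
  have hcos2 : Real.cos (π * q) * Real.cos (π * q) = 1 := by
    have h := Real.cos_sq_add_sin_sq (π * q)
    have hs : Real.sin (π * q) = 0 := by
      rw [mul_comm]; exact_mod_cast Real.sin_int_mul_pi q
    rw [hs] at h; nlinarith
  have hreal : Real.sin (π * (μ + q) / 2) / (π * (μ + q)) +
      Real.cos (π * q) * (Real.sin (π * (μ - q) / 2) / (π * (μ - q))) =
      Real.sin (π * (μ + q) / 2) * (1 / (π * (μ + q)) + 1 / (π * (μ - q))) := by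
    rw [hsin]
    linear_combination (Real.sin (π * (μ + q) / 2) / (π * (μ - q))) * hcos2
  rw [hcos]
  have h := congrArg (fun x : ℝ => (x : ℂ)) hreal
  push_cast at h ⊢
  exact h

end Summit.AnomalousDissipation.AnomalousDissipation.Theorems.SawtoothPulseCascade.K1Window
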